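import Summits.AtomisticToContinuum.Crystallization.Theorems.FrustratedLawDichotomyCellHalo

/-!
# FrustratedLawDichotomy · crux `AperiodicFrustratedLawGap` (stmt-AtomisticToContinuum-27623) — CELL-SOUND IX: ROW SETS OF RECORD
(cell decomp-a2c, lens-5 g113; KFILE-FORMAT-g113 §5 open point (a) resolved)

A K-file proves its floor for EVERY cell matrix `F` of an (uncountable) box `B`; the (228) atlas door wants a MEASURABLE row set `K i`.
Row set of record: the union over the RATIONAL matrices of the box, `ratBox B := B ∩ {rational matrices}` — countable, so
(253) `measurableSet_row` / `measurableSet_rowHalo` give `hK`, and the floor restricts from `B` (`rowFloor_rat`).  Nothing is lost in the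
residual inequality of (228): a configuration certified by the K-file but coherent only at irrational `F` lies in `(⋃ K i)ᶜ` with deficit
`e⋆ − rootEnergy μ ≤ −m_i ≤ 0`, i.e. it only DECREASES the residual integral `∫_{(⋃ K i)ᶜ} (e⋆ − rootEnergy) dP`.

House conventions: SI units · italic scalars, bold vectors, sans-serif tensors · numbered formulae only when referenced · en-dash for
ranges · References = cited works, numbered, alphabetical · no footnotes; Remarks at section ends · British spelling, -ise · Lennard-Jones
hyphenated; NASH capitalised as the Statement's notion · "folklore" tags standard bookkeeping; no new references are cited in this file.
-/

noncomputable section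

namespace Summit.AtomisticToContinuum.Crystallization.Theorems.FrustratedLawDichotomyCellRows

open MeasureTheory Metric Set
open scoped BigOperators
open Literature.MathematicalPhysics.StatisticalMechanics (lennardJones rootEnergy)
open Literature.Probability.Process (IsRootedHardCore)
open Summit.AtomisticToContinuum.Crystallization.Theorems.ChargedEnergyGapNegative (E3)
open Summit.AtomisticToContinuum.Crystallization.Theorems.FrustratedLawDichotomyCoherentSets (coherentAt)
open Summit.AtomisticToContinuum.Crystallization.Theorems.FrustratedLawDichotomyCoherentOn (coherentOn)
open Summit.AtomisticToContinuum.Crystallization.Theorems.FrustratedLawDichotomyCoherentFloorHalo (haloWindow)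
open Summit.AtomisticToContinuum.Crystallization.Theorems.FrustratedLawDichotomyCellHalo (measurableSet_row measurableSet_rowHalo)

variable {ι : Type*} [DecidableEq ι]

/-- the rational `3 × 3` real matrices. -/
def ratMatrices : Set (Matrix (Fin 3) (Fin 3) ℝ) := Set.range fun f : Fin 3 → Fin 3 → ℚ => Matrix.of fun i j => (f i j : ℝ)

omit [DecidableEq ι] in
/-- [folklore] -/
theorem ratMatrices_countable : ratMatrices.Countable := Set.countable_range _

/-- the RATIONAL SUB-BOX of a cell's parameter box: the row parameter set of record. -/
def ratBox (B : Set (Matrix (Fin 3) (Fin 3) ℝ)) : Set (Matrix (Fin 3) (Fin 3) ℝ) := B ∩ ratMatrices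

omit [DecidableEq ι] in
/-- [folklore] -/
theorem ratBox_countable (B : Set (Matrix (Fin 3) (Fin 3) ℝ)) : (ratBox B).Countable :=
  ratMatrices_countable.mono Set.inter_subset_right

omit [DecidableEq ι] in
/-- [folklore] -/
theorem ratBox_subset (B : Set (Matrix (Fin 3) (Fin 3) ℝ)) : ratBox B ⊆ B := Set.inter_subset_left

omit [DecidableEq ι] in
/-- a rational matrix of the box is in the rational sub-box (how the atlas enumerates row witnesses). [folklore] -/
theorem mem_ratBox {B : Set (Matrix (Fin 3) (Fin 3) ℝ)} (f : Fin 3 → Fin 3 → ℚ) (hF : (Matrix.of fun i j => (f i j : ℝ)) ∈ B) :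
    (Matrix.of fun i j => (f i j : ℝ)) ∈ ratBox B := ⟨hF, f, rfl⟩

omit [DecidableEq ι] in
/-- the rational row is a sub-row. [folklore] -/
theorem ratRow_subset {B : Set (Matrix (Fin 3) (Fin 3) ℝ)} (S : Matrix (Fin 3) (Fin 3) ℝ → Set (Measure E3)) :
    (⋃ F ∈ ratBox B, S F) ⊆ ⋃ F ∈ B, S F :=
  Set.biUnion_subset_biUnion_left (ratBox_subset B)

omit [DecidableEq ι] in
/-- ★ `hK` OF A CLASS-A ROW: the rational row of a cell is measurable. [folklore] -/
theorem measurableSet_ratRow (B : Set (Matrix (Fin 3) (Fin 3) ℝ)) (M : Finset ι) (posF : Matrix (Fin 3) (Fin 3) ℝ → ι → E3) (τ Rc : ℝ) :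
    MeasurableSet (⋃ F ∈ ratBox B, coherentAt (M.image (posF F)) τ Rc) :=
  measurableSet_row (ratBox_countable B) M posF τ Rc

omit [DecidableEq ι] in
/-- ★ `hK` OF A CLASS-H ROW: the rational halo row of a cell is measurable. [folklore] -/
theorem measurableSet_ratRowHalo (B : Set (Matrix (Fin 3) (Fin 3) ℝ)) (M : Finset ι) (posF : Matrix (Fin 3) (Fin 3) ℝ → ι → E3)
    (nF : Matrix (Fin 3) (Fin 3) ℝ → E3) (sF : Matrix (Fin 3) (Fin 3) ℝ → ℝ) (τ Rc : ℝ) :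
    MeasurableSet (⋃ F ∈ ratBox B, coherentOn (M.image (posF F)) τ (haloWindow (nF F) (sF F) Rc)) :=
  measurableSet_rowHalo (ratBox_countable B) M posF nF sF τ Rc

omit [DecidableEq ι] in
/-- ★ `hfloor` OF A ROW from a K-file floor over the whole box (any row shape `S`: class A `coherentAt`, class H `coherentOn … haloWindow`):
the (228) row pair of a cell is (`measurableSet_ratRow`, `rowFloor_rat`). [folklore] -/
theorem rowFloor_rat {B : Set (Matrix (Fin 3) (Fin 3) ℝ)} (S : Matrix (Fin 3) (Fin 3) ℝ → Set (Measure E3)) {c mc : ℝ}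
    (hfloor : ∀ μ : Measure E3, IsRootedHardCore (7 / 10) μ →
      (∀ p : E3, μ {p} ≠ 0 → ∀ w : E3, (∀ q : E3, μ {q} ≠ 0 → q ≠ p → w ≠ q) →
        ∑' q : {q : E3 // μ {q} ≠ 0 ∧ q ≠ p}, lennardJones (dist p (q : E3)) ≤
          ∑' q : {q : E3 // μ {q} ≠ 0 ∧ q ≠ p}, lennardJones (dist w (q : E3))) →
      μ ∈ (⋃ F ∈ B, S F) → c + mc ≤ rootEnergy lennardJones μ)
    (μ : Measure E3) (hμ : IsRootedHardCore (7 / 10) μ)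
    (hNash : ∀ p : E3, μ {p} ≠ 0 → ∀ w : E3, (∀ q : E3, μ {q} ≠ 0 → q ≠ p → w ≠ q) →
      ∑' q : {q : E3 // μ {q} ≠ 0 ∧ q ≠ p}, lennardJones (dist p (q : E3)) ≤
        ∑' q : {q : E3 // μ {q} ≠ 0 ∧ q ≠ p}, lennardJones (dist w (q : E3)))
    (hrow : μ ∈ ⋃ F ∈ ratBox B, S F) : c + mc ≤ rootEnergy lennardJones μ :=
  hfloor μ hμ hNash (ratRow_subset S hrow)

end Summit.AtomisticToContinuum.Crystallization.Theorems.FrustratedLawDichotomyCellRows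

end
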